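import Mathlib.Analysis.Calculus.MeanValue
import Mathlib.Geometry.Manifold.ContMDiffMFDeriv
import Literature.Geometry.Lorentzian.CausalityPushUp
import Literature.Geometry.Lorentzian.CurvatureSymmetries
import Literature.Geometry.Manifold.CompleteFlow
import Literature.Geometry.Manifold.SmoothExhaustionFunction
import HarnessLib

/-!
# A compact boundary of a future set is incompatible with a non-compact Cauchy hypersurface

The endgame of Penrose's singularity theorem (Penrose 1965; Hawking–Ellis 1973, §8.2, proof of
Theorem 1, pp. 263–264; O'Neill 1983, Ch. 14, proof of Theorem 61 and Corollary A, p. 437), in a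
form which uses neither the topological-hypersurface structure of achronal boundaries nor
Brouwer's invariance of domain.

**Theorem** (`frontier_eq_empty_of_isCompact_of_isCauchyHypersurface`). Let `(M, g, τ)` be a
connected time-oriented Lorentzian manifold (Hausdorff, second countable, finite-dimensional,
without boundary, `Cⁿ` metric with `n ≥ 2`) with a **non-compact** Cauchy hypersurface `S`.
Let `F ⊆ M` be a closed set with `I⁺(F) ⊆ F` (a *future set*, e.g. `F = J⁺(K)` when it is closed)
whose frontier `∂F` is compact. Then `∂F = ∅`, i.e. `F = ∅` or `F = M`.

In the printed proofs `∂F = ∂J⁺(𝒯)` is shown to be a compact topological hypersurface which the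
retraction along the integral curves of a timelike vector field maps injectively and continuously,
hence — by invariance of domain — homeomorphically onto an open and closed subset of `S`. Here the
openness is obtained instead from an elementary crossing argument (an integral curve through a
point near one that crosses `∂F` runs from `M ∖ F` into the interior of `F`, hence crosses `∂F`),
so that only the *continuity* of the retraction is needed.

## Contents (everything is proved; no definitions, no named facts)

* `TimeOrientation.exists_complete_timelike_vectorField` — a **complete** `C¹` future-directed
  timelike vector field `X` (rescale the orienting field `T` by `1/(1 + (Tf)²)` for a smooth
  exhaustion function `f`, Lee 2013, Prop. 2.28; then `|d(f ∘ γ)/dt| ≤ 1` along integral curves,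
  which therefore stay in compact sublevel sets: completeness by the escape lemma,
  `Literature.Geometry.Manifold.exists_isMIntegralCurve_of_apriori_isCompact`);
* its global flow `θ : ℝ × M → M` (`Literature.Geometry.Manifold.exists_contMDiff_globalFlow_of_complete`)
  has endless timelike orbits (`Literature.Geometry.Manifold.not_tendsto_atTop_of_maximal`), each
  of which meets the Cauchy hypersurface `S` exactly once, at a time `T(p)` depending
  **continuously** on `p` (achronality of `S` and openness of `I±(S)`); the retraction
  `ρ(p) = θ(T(p), p)` is continuous and onto `S`, so `S` is connected;
* the set of points whose orbit meets `∂F` is open (crossing argument), and its trace on `S` is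
  `ρ(∂F)`, compact; connectedness of `S` finishes the proof.

## References

* R. Penrose, *Gravitational collapse and space-time singularities*, Phys. Rev. Lett. 14 (1965),
  57–59.
* S. W. Hawking, G. F. R. Ellis, *The large scale structure of space-time*, CUP 1973, §8.2,
  Theorem 1 (pp. 263–264).
* B. O'Neill, *Semi-Riemannian geometry with applications to relativity*, Academic Press 1983,
  Ch. 14, Prop. 31 (p. 417), Theorem 61 and Corollary A (pp. 436–437).
* J. M. Lee, *Introduction to Smooth Manifolds*, 2nd ed. (2013), Prop. 2.28, Thm. 9.12.
-/

noncomputable section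

open Bundle Set Filter Function
open scoped Manifold ContDiff Topology

namespace Literature.Geometry.Lorentzian

variable {E : Type*} [NormedAddCommGroup E] [NormedSpace ℝ E] {H : Type*} [TopologicalSpace H]
  {I : ModelWithCorners ℝ E H} {n : ℕ∞ω} {M : Type*} [TopologicalSpace M] [ChartedSpace H M]
  [IsManifold I ∞ M]

namespace LorentzianMetric

variable {g : LorentzianMetric I n M} {τ : TimeOrientation g}

/-! ### A complete timelike vector field -/

omit [IsManifold I ∞ M] in
/-- The derivative of `f ∘ γ` along an integral curve `γ` of `X` at an interior parameter is
`df(X)`. [folklore] -/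
theorem hasDerivAt_comp_of_hasMFDerivAt {f : M → ℝ} {X : Π x : M, TangentSpace I x} {γ : ℝ → M}
    {t : ℝ} (hf : MDifferentiableAt I 𝓘(ℝ) f (γ t))
    (hγ : HasMFDerivAt 𝓘(ℝ, ℝ) I γ t ((1 : ℝ →L[ℝ] ℝ).smulRight (X (γ t)))) :
    HasDerivAt (f ∘ γ) (mfderiv I 𝓘(ℝ) f (γ t) (X (γ t))) t := by
  have h0 := (hf.hasMFDerivAt.comp t hγ).hasFDerivAt
  have hL : (mfderiv I 𝓘(ℝ) f (γ t)).comp ((1 : ℝ →L[ℝ] ℝ).smulRight (X (γ t))) =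
      (1 : ℝ →L[ℝ] ℝ).smulRight (mfderiv I 𝓘(ℝ) f (γ t) (X (γ t))) := by
    ext
    simp
  exact hasDerivAt_iff_hasFDerivAt.mpr (h0.congr_fderiv hL)

/-- **A complete future-directed timelike vector field.** On a Hausdorff, second countable,
finite-dimensional manifold without boundary with a `Cⁿ` (`n ≥ 1`) time-oriented Lorentzian
metric there is a `C¹` vector field `X`, everywhere timelike and future-directed, all of whose
integral curves are defined on the whole real line. Construction: `X = T / (1 + (Tf)²)` for the
orienting field `T` and a smooth exhaustion function `f` (Lee 2013, Prop. 2.28); along an integral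
curve `|d(f ∘ γ)/dt| = |Tf| / (1 + (Tf)²) ≤ 1`, so the curve stays in the compact sublevel set
`{f ≤ f(γ 0) + R}` for `|t| ≤ R`, and maximal integral curves confined to compact sets for bounded
times are complete (Lee 2013, Lemma 9.19). O'Neill 1983, Ch. 14, proof of Prop. 31 (integral
curves of a timelike vector field); Hawking–Ellis 1973, §8.2, p. 264 ("`𝓜` admits a past-directed
`C¹` timelike vector field"). [cite: LeeSmoothManifolds2013, Prop. 2.28 and Lemma 9.19] -/
theorem _root_.Literature.Geometry.Lorentzian.TimeOrientation.exists_complete_timelike_vectorField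
    [FiniteDimensional ℝ E] [T2Space M] [SecondCountableTopology M] [BoundarylessManifold I M]
    (τ : TimeOrientation g) (hn : 1 ≤ n) :
    ∃ X : Π x : M, TangentSpace I x,
      ContMDiff I I.tangent 1 (fun x ↦ (⟨x, X x⟩ : TangentBundle I M)) ∧
      (∀ x, g.IsTimelike (X x) ∧ τ.IsFutureDirected (X x)) ∧
      ∀ x, ∃ γ : ℝ → M, γ 0 = x ∧ IsMIntegralCurve γ X := by
  haveI : LocallyCompactSpace M := Manifold.locallyCompact_of_finiteDimensional I
  haveI : CompleteSpace E := FiniteDimensional.complete ℝ E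
  obtain ⟨f, hf, -, hfc⟩ :=
    Literature.Geometry.Manifold.exists_contMDiff_isCompact_preimage_Iic (I := I) (M := M)
  set T : Π x : M, TangentSpace I x := τ.vectorField with hT
  have hT1 : ContMDiff I I.tangent 1 (fun x ↦ (⟨x, T x⟩ : TangentBundle I M)) :=
    τ.contMDiff.of_le hn
  have hf2 : ContMDiff I 𝓘(ℝ) 2 f := hf.of_le (WithTop.coe_le_coe.mpr le_top)
  -- the derivative `Tf` of `f` along `T`, a `C¹` function
  set h : M → ℝ := fun x ↦ mvfderiv I f x (T x) with hh
  have hh1 : ContMDiff I 𝓘(ℝ) 1 h := fun x ↦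
    contMDiffAt_mvfderiv_apply (hf2 x) (hT1 x)
  -- the rescaling factor `ψ = 1 / (1 + (Tf)²)`
  set ψ : M → ℝ := fun x ↦ (1 + h x ^ 2)⁻¹ with hψ
  have hφ : ContDiff ℝ 1 (fun s : ℝ ↦ (1 + s ^ 2)⁻¹) :=
    (contDiff_const.add (contDiff_id.pow 2)).inv fun s ↦ by positivity
  have hψ1 : ContMDiff I 𝓘(ℝ) 1 ψ := hφ.comp_contMDiff hh1
  have hψpos : ∀ x, 0 < ψ x := fun x ↦ by positivity
  -- the field `X = ψ • T`
  set X : Π x : M, TangentSpace I x := fun x ↦ ψ x • T x with hX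
  have hX1 : ContMDiff I I.tangent 1 (fun x ↦ (⟨x, X x⟩ : TangentBundle I M)) :=
    hψ1.smul_section hT1
  have hXt : ∀ x, g.IsTimelike (X x) ∧ τ.IsFutureDirected (X x) := fun x ↦
    ⟨(τ.isTimelike x).smul (hψpos x).ne', (τ.isFutureDirected_vectorField x).smul (hψpos x)⟩
  refine ⟨X, hX1, hXt, fun x ↦ ?_⟩
  -- completeness from the a priori bound `f (γ t) ≤ f (γ 0) + |t|`
  refine Literature.Geometry.Manifold.exists_isMIntegralCurve_of_apriori_isCompact (I := I)
    (n := 1) hX1 le_rfl (fun x R ↦ ?_) x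
  refine ⟨f ⁻¹' Iic (f x + R), hfc _, fun γ J hJo hJc h0J hγ0 hγ t htJ htR ↦ ?_⟩
  -- the derivative of `f ∘ γ` on `J` is `ψ · Tf ∈ [-1, 1]`
  have hderiv : ∀ s ∈ J, HasDerivAt (f ∘ γ) (ψ (γ s) * h (γ s)) s := by
    intro s hs
    have hγs : HasMFDerivAt 𝓘(ℝ, ℝ) I γ s ((1 : ℝ →L[ℝ] ℝ).smulRight (X (γ s))) :=
      (hγ s hs).hasMFDerivAt (hJo.mem_nhds hs)
    have hfs : MDifferentiableAt I 𝓘(ℝ) f (γ s) := (hf2 (γ s)).mdifferentiableAt (by norm_num)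
    have h1 := hasDerivAt_comp_of_hasMFDerivAt hfs hγs
    have h2 : mfderiv I 𝓘(ℝ) f (γ s) (X (γ s)) = ψ (γ s) * h (γ s) := by
      simp only [hX, map_smul]
      rfl
    rwa [h2] at h1
  have hbound : ∀ s ∈ J, ‖ψ (γ s) * h (γ s)‖ ≤ 1 := by
    intro s _
    rw [Real.norm_eq_abs, abs_mul, abs_of_pos (hψpos _), hψ]
    rw [inv_mul_le_iff₀ (by positivity), mul_one]
    nlinarith [abs_nonneg (h (γ s)), sq_abs (h (γ s)), sq_nonneg (|h (γ s)| - 1 / 2)]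
  have hmv := hJc.convex.norm_image_sub_le_of_norm_hasDerivWithin_le
    (fun s hs ↦ (hderiv s hs).hasDerivWithinAt) hbound h0J htJ
  simp only [Function.comp_apply, hγ0, sub_zero, one_mul, Real.norm_eq_abs] at hmv
  show f (γ t) ≤ f x + R
  linarith [(abs_le.mp (le_trans hmv htR)).2, le_abs_self (f (γ t) - f x)]

/-! ### Orbits of a complete timelike vector field -/

section Orbits

variable {X : Π x : M, TangentSpace I x}

/-- An integral curve of a future-directed timelike vector field is a future timelike curve (on
all of `ℝ`). O'Neill 1983, Ch. 14, proof of Prop. 31 (p. 417). [cite: ONeillSemiRiemannian1983, Ch. 14, Prop. 31 (p. 417)] -/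
theorem isFutureTimelikeCurveOn_of_isMIntegralCurve
    (hXt : ∀ x, g.IsTimelike (X x) ∧ τ.IsFutureDirected (X x)) {γ : ℝ → M}
    (hγ : IsMIntegralCurve γ X) : g.IsFutureTimelikeCurveOn τ γ univ := fun t _ ↦
  futureTimelikeAt_of_hasMFDerivAt rfl (hγ t) (hXt _).1 (hXt _).2

/-- Along a future timelike curve on `ℝ`, later points are in the chronological future of earlier
ones. O'Neill 1983, Ch. 14, p. 402. [cite: ONeillSemiRiemannian1983, Ch. 14, p. 402] -/
theorem mem_chronologicalFuture_of_lt {γ : ℝ → M} (hγ : g.IsFutureTimelikeCurveOn τ γ univ)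
    {t₁ t₂ : ℝ} (h : t₁ < t₂) : γ t₂ ∈ g.chronologicalFuture τ {γ t₁} :=
  ⟨γ t₁, rfl, γ, t₁, t₂, h, hγ.mono (subset_univ _), rfl, rfl⟩

/-- **The integral curves of a complete nowhere-vanishing future timelike `C¹` field are endless
timelike curves** (they have no endpoint in either direction: Lee 2012, Lemma 9.19; O'Neill
1983, Ch. 1, Ex. 16 and Ch. 14, proof of Prop. 31, p. 416: "maximal integral curves of `X` are
inextendible"). [cite: ONeillSemiRiemannian1983, Ch. 14, Prop. 31 (pp. 416–417)] -/
theorem isEndlessTimelikeCurve_of_isMIntegralCurve [CompleteSpace E] [T2Space M]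
    [BoundarylessManifold I M]
    (hX : ContMDiff I I.tangent 1 (fun x ↦ (⟨x, X x⟩ : TangentBundle I M)))
    (hXt : ∀ x, g.IsTimelike (X x) ∧ τ.IsFutureDirected (X x)) {γ : ℝ → M}
    (hγ : IsMIntegralCurve γ X) : g.IsEndlessTimelikeCurve τ γ univ := by
  have hX0 : ∀ x, X x ≠ 0 := fun x ↦ (hXt x).1.ne_zero
  have hmax : ∀ (γ' : ℝ → M) (J : Set ℝ), IsOpen J → J.OrdConnected → ∀ t₀ ∈ J, t₀ ∈ univ →
      γ' t₀ = γ t₀ → IsMIntegralCurveOn γ' X J → J ⊆ univ := fun _ _ _ _ _ _ _ _ _ ↦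
    subset_univ _
  refine ⟨ordConnected_univ, isFutureTimelikeCurveOn_of_isMIntegralCurve hXt hγ,
    ⟨univ_nonempty, fun q hq ↦ ?_⟩, ⟨univ_nonempty, fun q hq ↦ ?_⟩⟩
  · exact Literature.Geometry.Manifold.not_tendsto_atTop_of_maximal hX hX0 isOpen_univ
      ordConnected_univ univ_nonempty (hγ.isMIntegralCurveOn _) hmax q hq
  · exact Literature.Geometry.Manifold.not_tendsto_atBot_of_maximal hX hX0 isOpen_univ
      ordConnected_univ univ_nonempty (hγ.isMIntegralCurveOn _) hmax q hq

end Orbits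

/-! ### The crossing time of a Cauchy hypersurface along a timelike flow -/

section CrossingTime

variable {θ : ℝ × M → M} {S : Set M} {T : M → ℝ}

/-- Membership in a chronological past, pointwise: `x ∈ I⁻(S)` iff some point of `S` lies in
`I⁺(x)`. O'Neill 1983, Ch. 14, pp. 402–403 (time duality). [cite: ONeillSemiRiemannian1983, Ch. 14, pp. 402–403] -/
theorem mem_chronologicalPast_iff_exists {x : M} :
    x ∈ g.chronologicalPast τ S ↔ ∃ s ∈ S, s ∈ g.chronologicalFuture τ {x} := by
  constructor
  · intro h
    rw [chronologicalPast, chronologicalFuture_eq_biUnion] at h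
    simp only [mem_iUnion, exists_prop] at h
    obtain ⟨s, hs, hxs⟩ := h
    exact ⟨s, hs, mem_chronologicalFuture_of_mem_chronologicalPast hxs⟩
  · rintro ⟨s, hs, hsx⟩
    rw [chronologicalPast, chronologicalFuture_eq_biUnion]
    simp only [mem_iUnion, exists_prop]
    exact ⟨s, hs, mem_chronologicalPast_of_mem_chronologicalFuture hsx⟩

/-- A point of `I⁺(x)` with `x ∈ S` lies in `I⁺(S)`. [folklore] -/
theorem mem_chronologicalFuture_of_mem {x y : M} (hx : x ∈ S)
    (hy : y ∈ g.chronologicalFuture τ {x}) : y ∈ g.chronologicalFuture τ S :=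
  chronologicalFuture_mono (singleton_subset_iff.mpr hx) hy

/-- **The crossing time is continuous.** Let `θ : ℝ × M → M` be a continuous map all of whose
curves `t ↦ θ (t, p)` are future timelike curves on `ℝ`, and let `S` be an achronal set met by
the curve through `p` at the time `T p` (and then only then). Then `T` is continuous: for `ε > 0` the
points `θ (T p₀ ± ε, p₀)` lie in the open sets `I⁺(S)`, `I⁻(S)`, hence so do `θ (T p₀ ± ε, p)`
for `p` near `p₀`, and by achronality the curve through `p` cannot meet `S` outside
`(T p₀ - ε, T p₀ + ε)`. O'Neill 1983, Ch. 14, Prop. 31 (p. 417: "the retraction … is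
continuous"). [cite: ONeillSemiRiemannian1983, Ch. 14, Prop. 31 (p. 417)] -/
theorem continuous_crossingTime [BoundarylessManifold I M] (hθc : Continuous θ)
    (hθt : ∀ p, g.IsFutureTimelikeCurveOn τ (fun t ↦ θ (t, p)) univ)
    (hA : g.IsAchronal τ S) (hT : ∀ p, θ (T p, p) ∈ S) : Continuous T := by
  have hdisj : Disjoint (g.chronologicalFuture τ S) S := (isAchronal_iff_disjoint S).mp hA
  refine continuous_iff_continuousAt.2 fun p₀ ↦ Metric.tendsto_nhds.2 fun ε hε ↦ ?_
  set t₀ := T p₀ with ht₀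
  -- `θ (t₀ + ε, p) ∈ I⁺(S)` and `θ (t₀ - ε, p) ∈ I⁻(S)` for `p` near `p₀`
  have hplus : ∀ᶠ p in 𝓝 p₀, θ (t₀ + ε, p) ∈ g.chronologicalFuture τ S := by
    have hc : Continuous fun p ↦ θ (t₀ + ε, p) := hθc.comp (continuous_const.prodMk continuous_id)
    refine hc.continuousAt.eventually_mem ((isOpen_chronologicalFuture_of_boundaryless g τ S).mem_nhds ?_)
    exact mem_chronologicalFuture_of_mem (hT p₀)
      (mem_chronologicalFuture_of_lt (hθt p₀) (by linarith))
  have hminus : ∀ᶠ p in 𝓝 p₀, θ (t₀ - ε, p) ∈ g.chronologicalPast τ S := by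
    have hc : Continuous fun p ↦ θ (t₀ - ε, p) := hθc.comp (continuous_const.prodMk continuous_id)
    refine hc.continuousAt.eventually_mem ((isOpen_chronologicalPast_of_boundaryless g τ S).mem_nhds ?_)
    exact mem_chronologicalPast_iff_exists.mpr
      ⟨θ (t₀, p₀), hT p₀, mem_chronologicalFuture_of_lt (hθt p₀) (by linarith)⟩
  filter_upwards [hplus, hminus] with p hp hm
  rw [Real.dist_eq, abs_sub_lt_iff]
  constructor
  · -- `T p < t₀ + ε`
    by_contra hle
    push Not at hle
    have hmem : θ (T p, p) ∈ g.chronologicalFuture τ S := by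
      rcases (show t₀ + ε ≤ T p by linarith).eq_or_lt with h | h
      · rw [← h]; exact hp
      · exact mem_chronologicalFuture_trans hp (mem_chronologicalFuture_of_lt (hθt p) h)
    exact Set.disjoint_left.mp hdisj hmem (hT p)
  · -- `t₀ - ε < T p`
    by_contra hle
    push Not at hle
    obtain ⟨s, hs, hsx⟩ := mem_chronologicalPast_iff_exists.mp hm
    have hmem : s ∈ g.chronologicalFuture τ {θ (T p, p)} := by
      rcases (show T p ≤ t₀ - ε by linarith).eq_or_lt with h | h
      · rw [h]; exact hsx
      · exact mem_chronologicalFuture_trans (mem_chronologicalFuture_of_lt (hθt p) h) hsx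
    exact Set.disjoint_left.mp hdisj (mem_chronologicalFuture_of_mem (hT p) hmem) hs

end CrossingTime

/-! ### Curves crossing a frontier -/

/-- A path which starts outside the closure of `F` and ends in the interior of `F` meets the
frontier of `F` (connectedness of the parameter interval). [folklore] -/
theorem exists_mem_frontier_of_path {F : Set M} {c : ℝ → M} {a b : ℝ} (hab : a ≤ b)
    (hc : ContinuousOn c (Icc a b)) (ha : c a ∉ closure F) (hb : c b ∈ interior F) :
    ∃ t ∈ Icc a b, c t ∈ frontier F := by
  by_contra hne
  push Not at hne
  have hK : IsPreconnected (c '' Icc a b) := isPreconnected_Icc.image c hc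
  have hsub : c '' Icc a b ⊆ interior F ∪ (closure F)ᶜ := by
    rintro _ ⟨t, ht, rfl⟩
    by_contra h
    simp only [mem_union, mem_compl_iff, not_or, not_not] at h
    exact hne t ht ⟨h.2, h.1⟩
  have hdisj : Disjoint (interior F) (closure F)ᶜ :=
    Set.disjoint_left.mpr fun x hx hx' ↦ hx' (interior_subset_closure hx)
  rcases hK.subset_or_subset isOpen_interior isClosed_closure.isOpen_compl hdisj hsub with h | h
  · exact ha (interior_subset_closure (h ⟨a, left_mem_Icc.mpr hab, rfl⟩))
  · exact h ⟨b, right_mem_Icc.mpr hab, rfl⟩ (interior_subset_closure hb)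

/-! ### The theorem -/

section Main

variable {θ : ℝ × M → M} {F : Set M}

/-- **Crossing a compact... : openness.** Let `θ : ℝ × M → M` be continuous with future timelike
curves `t ↦ θ (t, p)`, and let `F` be a closed set with `I⁺(F) ⊆ F`. Then the set of points `p`
whose curve meets the frontier `∂F` is open: if `θ (t₁, p) ∈ ∂F` then `θ (t₁ + 1, p)` lies in
the (open) interior of `F` and `θ (t₁ - 1, p)` outside the (closed) set `F`, so the same holds
for `p'` near `p`, whose curve therefore crosses `∂F` (`exists_mem_frontier_of_path`). This
replaces the invariance-of-domain step of Hawking–Ellis 1973, §8.2, p. 264 / O'Neill 1983,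
Ch. 14, proof of Thm. 61 (p. 437). [cite: HawkingEllis1973CUP, §8.2, Theorem 1 (proof, pp. 263–264)] -/
theorem isOpen_setOf_orbit_meets_frontier [BoundarylessManifold I M] (hθc : Continuous θ)
    (hθt : ∀ p, g.IsFutureTimelikeCurveOn τ (fun t ↦ θ (t, p)) univ)
    (hF : IsClosed F) (hIF : g.chronologicalFuture τ F ⊆ F) :
    IsOpen {p : M | ∃ t : ℝ, θ (t, p) ∈ frontier F} := by
  have hIint : g.chronologicalFuture τ F ⊆ interior F :=
    interior_maximal hIF (isOpen_chronologicalFuture_of_boundaryless g τ F)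
  rw [isOpen_iff_mem_nhds]
  rintro p ⟨t₁, ht₁⟩
  have heF : θ (t₁, p) ∈ F := hF.frontier_subset ht₁
  -- one time unit later the curve is in the interior of `F`, one unit earlier it is outside `F`
  have hplus : θ (t₁ + 1, p) ∈ interior F :=
    hIint (mem_chronologicalFuture_of_mem heF (mem_chronologicalFuture_of_lt (hθt p) (by linarith)))
  have hminus : θ (t₁ - 1, p) ∉ F := fun h ↦ ht₁.2
    (hIint (mem_chronologicalFuture_of_mem h (mem_chronologicalFuture_of_lt (hθt p) (by linarith))))
  have hev₁ : ∀ᶠ p' in 𝓝 p, θ (t₁ + 1, p') ∈ interior F :=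
    (hθc.comp (continuous_const.prodMk continuous_id)).continuousAt.eventually_mem
      (isOpen_interior.mem_nhds hplus)
  have hev₂ : ∀ᶠ p' in 𝓝 p, θ (t₁ - 1, p') ∈ Fᶜ :=
    (hθc.comp (continuous_const.prodMk continuous_id)).continuousAt.eventually_mem
      (hF.isOpen_compl.mem_nhds hminus)
  filter_upwards [hev₁, hev₂] with p' h₁ h₂
  have hcont : ContinuousOn (fun t ↦ θ (t, p')) (Icc (t₁ - 1) (t₁ + 1)) :=
    (hθc.comp (continuous_id.prodMk continuous_const)).continuousOn
  obtain ⟨t, -, ht⟩ := exists_mem_frontier_of_path (F := F) (by linarith) hcont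
    (by rwa [hF.closure_eq]) h₁
  exact ⟨t, ht⟩

/-- **A compact frontier of a future set is empty when there is a non-compact Cauchy
hypersurface** (the endgame of Penrose's theorem: Hawking–Ellis 1973, §8.2, proof of Theorem 1,
pp. 263–264; O'Neill 1983, Ch. 14, proof of Theorem 61 and Corollary A, p. 437). On a connected,
Hausdorff, second countable, finite-dimensional manifold without boundary with a `Cⁿ` (`n ≥ 2`)
time-oriented Lorentzian metric admitting a non-compact Cauchy hypersurface `S`, a closed set `F`
with `I⁺(F) ⊆ F` and compact frontier has empty frontier. Proof: flow `M` along a complete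
future timelike field (`TimeOrientation.exists_complete_timelike_vectorField`,
`Literature.Geometry.Manifold.exists_contMDiff_globalFlow_of_complete`); every orbit is an
endless timelike curve and meets `S` exactly once, at a continuously varying time
(`continuous_crossingTime`), which gives a continuous retraction `ρ` of `M` onto `S` — so `S` is
connected — under which the set of points of `S` whose orbit meets `∂F` is the compact set
`ρ(∂F)`; it is also open (`isOpen_setOf_orbit_meets_frontier`), hence all of `S` as soon as
`∂F ≠ ∅`, making `S` compact. [cite: HawkingEllis1973CUP, §8.2, Theorem 1 (proof, pp. 263–264)] -/
theorem frontier_eq_empty_of_isCompact_of_isCauchyHypersurface [FiniteDimensional ℝ E]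
    [T2Space M] [SecondCountableTopology M] [BoundarylessManifold I M] [ConnectedSpace M]
    (hn : 2 ≤ n) {S : Set M} (hS : g.IsCauchyHypersurface τ S) (hSc : ¬ IsCompact S)
    (hF : IsClosed F) (hIF : g.chronologicalFuture τ F ⊆ F) (hfr : IsCompact (frontier F)) :
    frontier F = ∅ := by
  haveI : CompleteSpace E := FiniteDimensional.complete ℝ E
  have hn1 : (1 : ℕ∞ω) ≤ n := le_trans one_le_two hn
  -- the complete timelike field and its global flow
  obtain ⟨X, hX, hXt, hXc⟩ := τ.exists_complete_timelike_vectorField hn1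
  obtain ⟨θ, hθs, hθ0, hθadd, hθint⟩ :=
    Literature.Geometry.Manifold.exists_contMDiff_globalFlow_of_complete (I := I) (n := 1) hX
      le_rfl hXc
  have hθc : Continuous θ := hθs.continuous
  have hθt : ∀ p, g.IsFutureTimelikeCurveOn τ (fun t ↦ θ (t, p)) univ := fun p ↦
    isFutureTimelikeCurveOn_of_isMIntegralCurve hXt (hθint p)
  have hθend : ∀ p, g.IsEndlessTimelikeCurve τ (fun t ↦ θ (t, p)) univ := fun p ↦
    isEndlessTimelikeCurve_of_isMIntegralCurve hX hXt (hθint p)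
  -- the crossing time
  have hex : ∀ p, ∃! t, t ∈ (univ : Set ℝ) ∧ θ (t, p) ∈ S := fun p ↦ hS _ _ (hθend p)
  choose T hT huniq using hex
  have hTS : ∀ p, θ (T p, p) ∈ S := fun p ↦ (hT p).2
  have huniq' : ∀ p t, θ (t, p) ∈ S → t = T p := fun p t ht ↦ huniq p t ⟨mem_univ _, ht⟩
  have hA : g.IsAchronal τ S := IsCauchyHypersurface.isAchronal_holds hn hS
  have hTc : Continuous T := continuous_crossingTime hθc hθt hA hTS
  -- the retraction `ρ p = θ (T p, p)` onto `S`
  set ρ : M → M := fun p ↦ θ (T p, p) with hρ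
  have hρc : Continuous ρ := hθc.comp (hTc.prodMk continuous_id)
  have hρS : ∀ p, ρ p ∈ S := hTS
  have hTS0 : ∀ s ∈ S, T s = 0 := fun s hs ↦ (huniq' s 0 (by rwa [hθ0])).symm
  have hρid : ∀ s ∈ S, ρ s = s := fun s hs ↦ by
    simp only [hρ, hTS0 s hs, hθ0]
  have hrange : range ρ = S :=
    Subset.antisymm (by rintro _ ⟨p, rfl⟩; exact hρS p) fun s hs ↦ ⟨s, hρid s hs⟩
  have hSconn : IsPreconnected S := hrange ▸ (isPreconnected_range hρc)
  -- the points whose orbit meets the frontier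
  set U : Set M := {p | ∃ t : ℝ, θ (t, p) ∈ frontier F} with hU
  have hUo : IsOpen U := isOpen_setOf_orbit_meets_frontier hθc hθt hF hIF
  -- `U ∩ S = ρ '' frontier F`
  have hUS : U ∩ S ⊆ ρ '' frontier F := by
    rintro s ⟨⟨t, ht⟩, hs⟩
    refine ⟨θ (t, s), ht, ?_⟩
    have h1 : θ (T (θ (t, s)) + t, s) ∈ S := by rw [← hθadd]; exact hTS _
    have h2 : T (θ (t, s)) + t = 0 := (huniq' s _ h1).trans (hTS0 s hs)
    show θ (T (θ (t, s)), θ (t, s)) = s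
    rw [hθadd, h2, hθ0]
  have hρU : ρ '' frontier F ⊆ U ∩ S := by
    rintro _ ⟨e, he, rfl⟩
    refine ⟨⟨-T e, ?_⟩, hρS e⟩
    show θ (-T e, θ (T e, e)) ∈ frontier F
    rwa [hθadd, neg_add_cancel, hθ0]
  -- if the frontier is nonempty, `S ⊆ ρ '' frontier F`, a compact set
  by_contra hne
  obtain ⟨e, he⟩ := nonempty_iff_ne_empty.mpr hne
  have hK : IsCompact (ρ '' frontier F) := hfr.image hρc
  have hSsub : S ⊆ ρ '' frontier F := by
    by_contra hnot
    obtain ⟨s, hs, hsK⟩ := not_subset.mp hnot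
    have hcover : S ⊆ U ∪ (ρ '' frontier F)ᶜ := fun x hx ↦ by
      by_cases hxK : x ∈ ρ '' frontier F
      · exact Or.inl (hρU hxK).1
      · exact Or.inr hxK
    obtain ⟨x, hxS, hxU, hxK⟩ := hSconn U (ρ '' frontier F)ᶜ hUo hK.isClosed.isOpen_compl hcover
      ⟨ρ e, hρS e, (hρU ⟨e, he, rfl⟩).1⟩ ⟨s, hs, hsK⟩
    exact hxK (hUS ⟨hxU, hxS⟩)
  exact hSc (hK.of_isClosed_subset (IsCauchyHypersurface.isClosed_holds hn hS) hSsub)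

end Main

end LorentzianMetric

end Literature.Geometry.Lorentzian

end
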